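import Mathlib
import Literature.NumberTheory.GaloisRepresentations.AbsGaloisGroup
import Literature.NumberTheory.GaloisRepresentations.ArtinRestriction
import Literature.NumberTheory.GaloisRepresentations.ModNCyclotomicCharacter
import Literature.NumberTheory.GaloisRepresentations.CyclotomicCharacterSurjectiveProofs
import Literature.NumberTheory.GaloisRepresentations.SorensenPatching
import HarnessLib

/-!
# Imaginary quadratic fields, complex conjugation and `ℚ(ζ_p)` inside `Γ_ℚ` (proofs)

`Proofs` file (theorems only, no definition, no named fact) in topic
`NumberTheory/GaloisRepresentations`, landed by the seat of stmt-Langlands-12920 (stub S1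
`stub_inertBMPrimeSupply` of the line `descend-raise-basechange`: inert Billerey–Menares primes),
in the tree's `Γ_ℚ`-vocabulary (`Field.absoluteGaloisGroup`, `absGaloisRestrict ℚ F` and its range
`Gal(ℚ̄/e(F))`, `IsComplexConjugation`, `modNCyclotomicCharacter`):

* `Rat.not_mem_range_absGaloisRestrict_of_isComplexConjugation` — a complex conjugation of `Γ_ℚ`
  acts nontrivially on a totally complex number field `F` (it is not in `Gal(ℚ̄/F)`).
* `Rat.modNCyclotomicCharacter_surjective` — `χ_N : Γ_ℚ → (ℤ/N)ˣ` is onto (irreducibility of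
  `Φ_N` over `ℚ`, through the tree's `RootOfUnityAction.exists_smul_eq_pow_and_smul_eq_self`;
  Washington, *Cyclotomic Fields*, Thm. 2.5).
* `Rat.exists_gaussSum` — for an odd prime `p`, the quadratic Gauss sum `s = ∑ (a/p) ζ_p^a ∈ ℚ̄`:
  `s ≠ 0`, `s² = (-1/p) p` (Mathlib `gaussSum_sq`), and `τ s = (χ_p(τ)/p) s` for `τ ∈ Γ_ℚ`
  (Mathlib `gaussSum_mulShift`); Ireland–Rosen, Ch. 6, Prop. 6.3.2 and §3.
* `Rat.isGalois_algebraicClosure`, `Rat.exists_eq_of_forall_range_absGaloisRestrict_smul` — the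
  infinite Galois correspondence for `e(F) ⊆ ℚ̄`: an element fixed by `Gal(ℚ̄/F)` comes from `F`.
* `Rat.exists_modNCyclotomicCharacter_eq_one_and_not_mem_range` — **`F ⊄ ℚ(ζ_p)` off the Mazur
  corner**: for `F` imaginary quadratic and `p ≥ 5`, unless `p ≡ 3 (mod 4)` and `-p` is a square in
  `F` there is `g ∈ Γ_ℚ` trivial on `μ_p` and nontrivial on `F` (the quadratic subfield of `ℚ(ζ_p)`
  is `ℚ(√p*)`, `p* = (-1/p) p`: an index-two subgroup contains all squares and `χ_p` is onto, so
  `Gal(ℚ̄/F) ⊇ Gal(ℚ̄/ℚ(ζ_p))` forces `Gal(ℚ̄/F) = χ_p⁻¹((ℤ/p)ˣ²)`; complex conjugation gives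
  `(-1/p) = -1`, and the Gauss sum is then fixed by `Gal(ℚ̄/F)`).
* `Rat.isPrime_span_natCast_of_unique_place` — if `v = (M)` is unramified in `F` with a single
  place `w` above it then `M 𝓞_F = w` is prime (Mathlib `Ideal.map_algebraMap_eq_finsetProd_pow`).

## References

* K. Ireland, M. Rosen, *A Classical Introduction to Modern Number Theory*, GTM 84 (2nd ed. 1990),
  Ch. 6 (quadratic Gauss sums). [IrelandRosen1990]
* L. C. Washington, *Introduction to Cyclotomic Fields*, GTM 83 (2nd ed. 1997), Ch. 2
  (`Gal(ℚ(ζ_N)/ℚ) ≃ (ℤ/N)ˣ`, the quadratic subfield of `ℚ(ζ_p)`). [Washington1997]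
* J. Neukirch, *Algebraic Number Theory* (1999), Ch. I §8 (splitting of primes). [NeukirchANT1999]

## Design

Theorems only; `namespace Literature.NumberTheory.GaloisRepresentations`, `Rat.` prefix for the
`ℚ`-specific statements (as in `RatPlaceTwoProofs`).  The two `ℚ`-algebra structures on
`AlgebraicClosure ℚ` (`AlgebraicClosure.instAlgebra` and `DivisionRing.toRatAlgebra`) are
definitionally but not reducibly equal; `Rat.isGalois_algebraicClosure` re-types Mathlib's
`IsAlgClosure.isGalois` once.  Axioms: `propext`, `Classical.choice`, `Quot.sound`.
-/

noncomputable section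

open Field NumberField IsDedekindDomain

namespace Literature.NumberTheory.GaloisRepresentations

/-! ### Complex conjugation and totally complex fields -/

/-- **Complex conjugation acts nontrivially on a totally complex field**: for `F` totally complex,
no complex conjugation `c ∈ Γ_ℚ` lies in the image `Gal(ℚ̄/e(F))` of `Γ_F → Γ_ℚ` (otherwise
`ι ∘ e : F → ℂ` would be a real embedding). [folklore] -/
theorem Rat.not_mem_range_absGaloisRestrict_of_isComplexConjugation (F : Type*) [Field F]
    [NumberField F] (hF : IsTotallyComplex F) {c : absoluteGaloisGroup ℚ}
    (hc : IsComplexConjugation (Rat.castHom ℝ) c) :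
    c ∉ ((absGaloisRestrict ℚ F).range : Subgroup (absoluteGaloisGroup ℚ)) := by
  obtain ⟨e, he⟩ := exists_mem_range_absGaloisRestrict_iff ℚ F
  obtain ⟨ι, -, hι⟩ := isComplexConjugation_iff.mp hc
  intro hmem
  rw [he] at hmem
  let φ : F →+* ℂ := ι.comp e.toRingHom
  have hreal : ComplexEmbedding.IsReal φ := by
    refine RingHom.ext fun x => ?_
    change starRingEnd ℂ (ι (e x)) = ι (e x)
    rw [← hι, hmem x]
  exact InfinitePlace.isComplex_mk_iff.mp (hF.isComplex (InfinitePlace.mk φ)) hreal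

/-! ### The mod `N` cyclotomic character of `ℚ` is onto; the quadratic Gauss sum -/

/-- **`χ_N : Γ_ℚ → (ℤ/N)ˣ` is surjective** (Washington, *Cyclotomic Fields*, Thm. 2.5:
`Gal(ℚ(ζ_N)/ℚ) ≃ (ℤ/Nℤ)ˣ`, i.e. irreducibility of `Φ_N` over `ℚ`, Mathlib
`Polynomial.cyclotomic.irreducible_rat`; through the tree's
`RootOfUnityAction.exists_smul_eq_pow_and_smul_eq_self`). [folklore] -/
theorem Rat.modNCyclotomicCharacter_surjective (N : ℕ) [NeZero N] [NeZero (N : ℚ)] :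
    Function.Surjective (modNCyclotomicCharacter ℚ N) := by
  intro a
  obtain ⟨ζ, hζ⟩ := HasEnoughRootsOfUnity.exists_primitiveRoot (AlgebraicClosure ℚ) N
  have hirr : Irreducible (Polynomial.cyclotomic (N * 1) ℚ) := by
    rw [mul_one]
    exact Polynomial.cyclotomic.irreducible_rat (NeZero.pos N)
  obtain ⟨σ, hσ, -⟩ := RootOfUnityAction.exists_smul_eq_pow_and_smul_eq_self (K := ℚ)
    (Nat.coprime_one_right N) hirr a
  refine ⟨σ, Units.ext ?_⟩
  rw [modNCyclotomicCharacter_eq_of_smul_eq_pow ℚ N hζ σ (hσ ζ hζ.pow_eq_one),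
    ZMod.natCast_zmod_val]

/-- **The quadratic Gauss sum in `ℚ̄`** (Ireland–Rosen, Ch. 6, Prop. 6.3.2 and the proof of
Thm. 1 in §3).  For an odd prime `p` there is `s ∈ ℚ̄` (namely `∑_a (a/p) ζ_p^a`) with `s ≠ 0`,
`s² = (-1/p) · p` (Mathlib `gaussSum_sq`), on which `Γ_ℚ` acts through the Legendre symbol of the
mod `p` cyclotomic character: `τ s = (χ_p(τ)/p) s` (Mathlib `gaussSum_mulShift`). [folklore] -/
theorem Rat.exists_gaussSum {p : ℕ} [Fact p.Prime] [NeZero (p : ℚ)] (hp2 : p ≠ 2) :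
    ∃ s : AlgebraicClosure ℚ, s ≠ 0 ∧
      s ^ 2 = ((quadraticChar (ZMod p) (-1) : ℤ) : AlgebraicClosure ℚ) * p ∧
      ∀ τ : absoluteGaloisGroup ℚ,
        τ • s = ((quadraticChar (ZMod p) (modNCyclotomicCharacter ℚ p τ : ZMod p) : ℤ) :
          AlgebraicClosure ℚ) * s := by
  classical
  haveI : NeZero p := ⟨(Fact.out : p.Prime).ne_zero⟩
  obtain ⟨ζ, hζ⟩ := HasEnoughRootsOfUnity.exists_primitiveRoot (AlgebraicClosure ℚ) p
  set ψ : AddChar (ZMod p) (AlgebraicClosure ℚ) := AddChar.zmodChar p hζ.pow_eq_one with hψdef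
  set χ : MulChar (ZMod p) (AlgebraicClosure ℚ) :=
    (quadraticChar (ZMod p)).ringHomComp (Int.castRingHom (AlgebraicClosure ℚ)) with hχ
  have hpchar : ringChar (ZMod p) ≠ 2 := by rwa [ZMod.ringChar_zmod_n]
  have hχ1 : χ ≠ 1 :=
    (MulChar.ringHomComp_ne_one_iff (RingHom.injective_int _)).mpr (quadraticChar_ne_one hpchar)
  have hχ2 : χ.IsQuadratic := (quadraticChar_isQuadratic (ZMod p)).comp _
  have hψ : ψ.IsPrimitive := AddChar.zmodChar_primitive_of_primitive_root p hζ
  have hχapp : ∀ a : ZMod p, χ a = ((quadraticChar (ZMod p) a : ℤ) : AlgebraicClosure ℚ) :=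
    fun a => rfl
  refine ⟨gaussSum χ ψ, ?_, ?_, fun τ => ?_⟩
  · refine gaussSum_ne_zero_of_nontrivial ?_ hχ1 hψ
    rw [ZMod.card]
    exact_mod_cast (Fact.out : p.Prime).ne_zero
  · rw [gaussSum_sq hχ1 hχ2 hψ, ZMod.card, hχapp]
  · -- `τ` acts on `s = ∑ χ(a) ζ^a` by `ζ ↦ ζ^n`, `n = χ_p(τ)`, giving the shifted Gauss sum
    set u : (ZMod p)ˣ := modNCyclotomicCharacter ℚ p τ with hu
    have hζτ : τ • ζ = ζ ^ (u : ZMod p).val := modNCyclotomicCharacter_spec ℚ p τ ζ hζ.pow_eq_one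
    have hshift : τ • gaussSum χ ψ = gaussSum χ (ψ.mulShift u) := by
      rw [absoluteGaloisGroup.smul_def, gaussSum, gaussSum, map_sum]
      refine Finset.sum_congr rfl fun a _ => ?_
      rw [map_mul, hχapp, map_intCast, AddChar.mulShift_apply, hψdef, AddChar.zmodChar_apply,
        AddChar.zmodChar_apply, map_pow, ← absoluteGaloisGroup.smul_def, hζτ, ← pow_mul,
        ZMod.val_mul, ← pow_eq_pow_mod _ hζ.pow_eq_one]
    have hkey := gaussSum_mulShift χ ψ u
    rw [← hshift] at hkey
    have hsq : χ (u : ZMod p) * χ (u : ZMod p) = 1 := by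
      rw [hχapp, ← Int.cast_mul, ← pow_two, quadraticChar_sq_one (Units.ne_zero u), Int.cast_one]
    calc τ • gaussSum χ ψ = (χ (u : ZMod p) * χ (u : ZMod p)) * (τ • gaussSum χ ψ) := by
          rw [hsq, one_mul]
      _ = χ (u : ZMod p) * gaussSum χ ψ := by rw [mul_assoc, hkey]
      _ = _ := by rw [hχapp]

/-! ### Elements of `ℚ̄` fixed by `Gal(ℚ̄/F)` -/

/-- `IsGalois ℚ ℚ̄` for the default `ℚ`-algebra structure on `ℚ̄ = AlgebraicClosure ℚ` (Mathlib's
instance `IsAlgClosure.isGalois`, re-typed through the `Rat`-algebra diamond). [folklore] -/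
theorem Rat.isGalois_algebraicClosure : IsGalois ℚ (AlgebraicClosure ℚ) :=
  @IsAlgClosure.isGalois ℚ (AlgebraicClosure ℚ) _ _ (AlgebraicClosure.instAlgebra ℚ) inferInstance
    inferInstance

/-- An element of `ℚ̄` fixed by the image `Gal(ℚ̄/e(F))` of `Γ_F → Γ_ℚ` comes from `F`: the
infinite Galois correspondence (Mathlib `InfiniteGalois.fixedField_fixingSubgroup`) for the
subfield `e(F) ⊆ ℚ̄`, `e` the embedding of `exists_mem_range_absGaloisRestrict_iff`. [folklore] -/
theorem Rat.exists_eq_of_forall_range_absGaloisRestrict_smul (F : Type*) [Field F] [Algebra ℚ F]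
    [Algebra.IsAlgebraic ℚ F] {s : AlgebraicClosure ℚ}
    (hs : ∀ τ ∈ ((absGaloisRestrict ℚ F).range : Subgroup (absoluteGaloisGroup ℚ)), τ • s = s) :
    ∃ (e : F →ₐ[ℚ] AlgebraicClosure ℚ) (x : F), e x = s := by
  haveI := Rat.isGalois_algebraicClosure
  obtain ⟨e, he⟩ := exists_mem_range_absGaloisRestrict_iff ℚ F
  refine ⟨e, ?_⟩
  set E : IntermediateField ℚ (AlgebraicClosure ℚ) := e.fieldRange with hE
  have hmem : s ∈ IntermediateField.fixedField E.fixingSubgroup := by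
    rw [IntermediateField.mem_fixedField_iff]
    intro f hf
    have hf' : ∀ x : F, ((absoluteGaloisGroup.toAlgEquiv ℚ).symm f) • e x = e x := by
      intro x
      rw [absoluteGaloisGroup.toAlgEquiv_symm_apply]
      exact (IntermediateField.mem_fixingSubgroup_iff _ _).mp hf (e x) ⟨x, rfl⟩
    have := hs _ ((he _).mpr hf')
    rwa [absoluteGaloisGroup.toAlgEquiv_symm_apply] at this
  rw [InfiniteGalois.fixedField_fixingSubgroup E, hE] at hmem
  exact (AlgHom.mem_fieldRange (f := e) (y := s)).mp hmem

/-! ### The Mazur corner: imaginary quadratic fields inside `ℚ(ζ_p)` -/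

/-- **`F ⊄ ℚ(ζ_p)` off the Mazur corner.** Let `F` be an imaginary quadratic field and `p ≥ 5` a
prime.  Unless `p ≡ 3 (mod 4)` and `-p` is a square in `F` (i.e. `F = ℚ(√-p) ⊂ ℚ(ζ_p)`), there
is `g ∈ Γ_ℚ` acting trivially on `μ_p` (`χ_p(g) = 1`) but nontrivially on `F`
(`g ∉ Gal(ℚ̄/e(F))`).  Otherwise `Gal(ℚ̄/ℚ(ζ_p)) ≤ Gal(ℚ̄/F)`; an index-two subgroup contains all
squares and `χ_p` is onto `(ℤ/p)ˣ`, so `Gal(ℚ̄/F) = χ_p⁻¹((ℤ/p)ˣ²)`; complex conjugation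
(`χ_p(c) = -1`, `c ∉ Gal(ℚ̄/F)` as `F` is imaginary) forces `(-1/p) = -1`, i.e. `p ≡ 3 (4)`, and
the Gauss sum `s`, `s² = -p`, is fixed by `Gal(ℚ̄/F)`, so lies in `F` (Washington, Ch. 2: the
quadratic subfield of `ℚ(ζ_p)` is `ℚ(√p*)`; Ireland–Rosen Ch. 6). [folklore] -/
theorem Rat.exists_modNCyclotomicCharacter_eq_one_and_not_mem_range (F : Type*) [Field F]
    [NumberField F] (hF : IsTotallyComplex F) (h2 : Module.finrank ℚ F = 2) {p : ℕ} [Fact p.Prime]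
    [NeZero (p : ℚ)] (hp5 : 5 ≤ p) (hcorner : ¬ (p % 4 = 3 ∧ ∃ x : F, x ^ 2 = -(p : F))) :
    ∃ g : absoluteGaloisGroup ℚ, modNCyclotomicCharacter ℚ p g = 1 ∧
      g ∉ ((absGaloisRestrict ℚ F).range : Subgroup (absoluteGaloisGroup ℚ)) := by
  classical
  by_contra hcon
  push Not at hcon
  haveI : NeZero p := ⟨(Fact.out : p.Prime).ne_zero⟩
  haveI : FiniteDimensional ℚ F := Module.finite_of_finrank_eq_succ h2
  haveI : Algebra.IsQuadraticExtension ℚ F := ⟨h2⟩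
  haveI : IsGalois ℚ F := inferInstance
  have hp2 : p ≠ 2 := by omega
  have hpchar : ringChar (ZMod p) ≠ 2 := by rwa [ZMod.ringChar_zmod_n]
  set H : Subgroup (absoluteGaloisGroup ℚ) := (absGaloisRestrict ℚ F).range with hH
  have hHi : H.index = 2 := (SorensenPatching.index_range_absGaloisRestrict ℚ F).trans h2
  set ω := modNCyclotomicCharacter ℚ p with hω
  set χ := quadraticChar (ZMod p) with hχdef
  -- Step 1: `χ(ω τ) = 1 ⇒ τ ∈ H`
  have step1 : ∀ τ : absoluteGaloisGroup ℚ, χ (ω τ : ZMod p) = 1 → τ ∈ H := by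
    intro τ hτ
    obtain ⟨r, hr⟩ := (quadraticChar_one_iff_isSquare (Units.ne_zero _)).mp hτ
    have hr0 : r ≠ 0 := by
      rintro rfl
      exact Units.ne_zero (ω τ) (by rw [hr, mul_zero])
    obtain ⟨ρ, hρ⟩ := Rat.modNCyclotomicCharacter_surjective p (Units.mk0 r hr0)
    rw [← hω] at hρ
    have hker : ω (τ * (ρ * ρ)⁻¹) = 1 := by
      refine Units.ext ?_
      rw [map_mul, map_inv, map_mul, hρ, Units.val_mul, Units.val_one, Units.val_inv_eq_inv_val,
        Units.val_mul, Units.val_mk0, ← hr, mul_inv_cancel₀ (Units.ne_zero _)]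
    have h3 := H.mul_mem (hcon _ hker) (Subgroup.mul_self_mem_of_index_two hHi ρ)
    rwa [inv_mul_cancel_right] at h3
  -- Step 2: complex conjugation: `χ(-1) = -1`, so `p ≡ 3 (mod 4)`
  obtain ⟨c, hc⟩ := exists_isComplexConjugation (K := ℚ) (Rat.castHom ℝ)
  have hcH : c ∉ H := Rat.not_mem_range_absGaloisRestrict_of_isComplexConjugation F hF hc
  have hωc : (ω c : ZMod p) = -1 := modNCyclotomicCharacter_of_isComplexConjugation hc
  have hχc : χ (ω c : ZMod p) = -1 := by
    rcases quadraticChar_dichotomy (Units.ne_zero (ω c)) with h | h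
    · exact absurd (step1 c h) hcH
    · exact h
  have hχneg : χ (-1) = -1 := by rw [← hωc]; exact hχc
  have hp43 : p % 4 = 3 := by
    have h := quadraticChar_neg_one hpchar
    rw [ZMod.card, ZMod.χ₄_nat_eq_if_mod_four] at h
    rw [← hχdef] at h
    rw [h] at hχneg
    split_ifs at hχneg with h0 h1
    all_goals omega
  -- Step 3: `τ ∈ H ⇒ χ(ω τ) = 1`
  have step3 : ∀ τ ∈ H, χ (ω τ : ZMod p) = 1 := by
    intro τ hτ
    rcases quadraticChar_dichotomy (Units.ne_zero (ω τ)) with h | h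
    · exact h
    · exfalso
      have hcτ : χ (ω (c * τ) : ZMod p) = 1 := by
        rw [map_mul, Units.val_mul, map_mul, hχc, h]
        norm_num
      have h4 := H.mul_mem (step1 _ hcτ) (H.inv_mem hτ)
      rw [mul_inv_cancel_right] at h4
      exact hcH h4
  -- Step 4: the Gauss sum is fixed by `H`, hence lies in `F`, and squares to `-p`
  obtain ⟨s, -, hs2, hsτ⟩ := Rat.exists_gaussSum (p := p) hp2
  have hfix : ∀ τ ∈ H, τ • s = s := fun τ hτ => by
    rw [hsτ τ, ← hω, step3 τ hτ, Int.cast_one, one_mul]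
  obtain ⟨e, x, hx⟩ := Rat.exists_eq_of_forall_range_absGaloisRestrict_smul F hfix
  refine hcorner ⟨hp43, x, e.toRingHom.injective ?_⟩
  change e (x ^ 2) = e (-(p : F))
  rw [map_pow, hx, hs2, ← hχdef, hχneg, map_neg, map_natCast]
  push_cast
  ring

/-! ### An unramified rational prime with a single place above it -/

/-- **An unramified rational prime with a single place above it generates a prime ideal.**  If
`v = (M)` is unramified in the number field `F` and `w` is the only place of `F` above `v`, then
`M 𝓞_F = w` is prime (`M 𝓞_F = ∏_{P ∣ v} P^{e_P}`, Mathlib `Ideal.map_algebraMap_eq_finsetProd_pow`,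
with one factor and `e = 1`).  Neukirch, *Algebraic Number Theory*, Ch. I (8.2)–(8.3). [folklore] -/
theorem Rat.isPrime_span_natCast_of_unique_place (F : Type*) [Field F] [NumberField F]
    {v : HeightOneSpectrum (𝓞 ℚ)} {M : ℕ} (hM : v.asIdeal = Ideal.span {(M : 𝓞 ℚ)})
    (hunr : Algebra.IsUnramifiedIn (𝓞 F) v.asIdeal)
    {w : HeightOneSpectrum (𝓞 F)} (hw : w.under (𝓞 ℚ) = v)
    (huniq : ∀ w' : HeightOneSpectrum (𝓞 F), w'.under (𝓞 ℚ) = v → w' = w) :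
    (Ideal.span {(M : 𝓞 F)}).IsPrime := by
  classical
  haveI : v.asIdeal.IsMaximal := v.isMaximal
  haveI : Module.Finite (𝓞 ℚ) (𝓞 F) := IsIntegralClosure.finite (𝓞 ℚ) ℚ F (𝓞 F)
  have hover : w.asIdeal.LiesOver v.asIdeal := ⟨by rw [← hw]; rfl⟩
  have hI : Ideal.span {(M : 𝓞 F)} = (v.asIdeal).map (algebraMap (𝓞 ℚ) (𝓞 F)) := by
    rw [hM, Ideal.map_span, Set.image_singleton, map_natCast]
  have hset : (v.asIdeal.primesOver (𝓞 F)).toFinset = {w.asIdeal} := by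
    ext P
    simp only [Set.mem_toFinset, Finset.mem_singleton]
    constructor
    · intro hP
      set w' : HeightOneSpectrum (𝓞 F) :=
        ⟨P, hP.1, Ideal.ne_bot_of_mem_primesOver v.ne_bot hP⟩ with hw'
      have hw'v : w'.under (𝓞 ℚ) = v := HeightOneSpectrum.ext hP.2.over.symm
      exact (congrArg HeightOneSpectrum.asIdeal (huniq w' hw'v) : w'.asIdeal = w.asIdeal)
    · rintro rfl
      exact ⟨w.isPrime, hover⟩
  rw [hI, Ideal.map_algebraMap_eq_finsetProd_pow (R := 𝓞 F) v.ne_bot, hset, Finset.prod_singleton,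
    Ideal.ramificationIdx_eq_one_iff.mpr (hunr w.asIdeal w.isPrime hover), pow_one]
  exact w.isPrime

end Literature.NumberTheory.GaloisRepresentations
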